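import Literature.Computability.Cryptography.LWECandE2Run
import HarnessLib

/-!
# The machine's candidate-2 run as a typed polynomial-time program: the transformed items and the test's subroutine queries

Topic `Computability/Cryptography` (LWE), grouping namespace `BLPRS2013.KProg`; program-level companion of `LWECandE2Run.lean` (`c2Bit`: raise, pad, extend, shift,
hybrid `T₂`, test, along one coin string cut into regions). The machine of hypothesis `h₃` (`BLPRSReduction.lean`, pqc.S21) is a non-adaptive transducer whose query
function must produce, for a query index `j`, the `j`-th input handed to the subroutine `D₃` by the TEST run on the transformed tuple; this file assembles that function
from the programs of the earlier files (`raiseOf`, `padFlat`, `dimExtFlat`, `shiftFlat`, `hybT2Of`, `tQuery`) against ONE record, and proves it typed polynomial time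
(everything PROVED; definitions with bodies; no named fact):

* `C2Rec` (the run record: the raising sampler's record, `M`, `(Q, L, d+1)`, hybrid `T₂`'s record, the test record, the four region widths) and `c2RecOf` (the genuine one);
* `c2ItemsOf r (items, coins)` (the transformed items), `c2RestOf r coins` (the test's coins), **`c2QueryOf r (items, (coins, j))`** (the `j`-th subroutine input and its coins),
  `c2VerdictOf` (the verdict from the answer bits);
* `c2ItemsOf_c2RecOf`, `c2RestOf_c2RecOf`, **`c2Bit_eq`** (the closed-form verdict bit of `LWECandE2Run.lean` is the verdict program on the answer bits of the query program's
  queries: `c2Bit … items coins = c2VerdictOf (c2RecOf …) (ofFn j ↦ dec ⟨query j⟩)`);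
* `c2ItemsOf_codeFP`, `c2RestOf_codeFP`, **`c2QueryOf_codeFP`**, `c2VerdictOf_codeFP`.

## References

* Z. Brakerski, A. Langlois, C. Peikert, O. Regev, D. Stehlé, *Classical hardness of learning with errors*, STOC 2013; arXiv:1306.0281, Thm. 4.1 (proof), Lemma 2.15
  and §5. [BrakerskiEtAl2013]
* R. E. Ladner, N. A. Lynch, A. L. Selman, *A comparison of polynomial time reducibilities*, TCS 1 (1975), §3 (non-adaptive queries). [LadnerLynchSelman1975]
* S. Arora, B. Barak, *Computational Complexity: A Modern Approach*, CUP 2009, §1.3, §3.4. [AroraBarak2009]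
-/

noncomputable section

open PMF Literature.Probability.Distributions Literature.Algebra.EuclideanLattices

namespace Literature.Computability.Cryptography

namespace BLPRS2013

namespace KProg

open Polynomial Literature.Computability.Complexity Literature.Computability.Complexity.CodeFP Literature.Computability.QuantumComplexity
  GaussRejMachine LWE LWE.MP12 LWE.MP12.Prog
open Literature.Algebra.EuclideanLattices (encodeRat encodeRat_injective)

/-! ### The record -/

/-- **The candidate-2 run record**: `(((raising sampler record, M), ((Q, L), d+1)), hybrid-T₂ record)`, then `(test record, (W₁, W₂, W₃, W₄))` (counts and widths unary).
[folklore] -/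
abbrev C2Rec : Type := (((PRec × ℕ) × ((ℕ × ℕ) × ℕ)) × HRec) × (TRec × (ℕ × ℕ × ℕ × ℕ))

/-- Its code. [folklore] -/
abbrev c2RecE : C2Rec → List Bool :=
  pairE (pairE (pairE (pairE pRecE unE) (pairE (pairE natE unE) unE)) hRecE) (pairE tRecE (pairE unE (pairE unE (pairE unE unE))))

section Defs

variable (q m₃ : ℕ → ℕ) (c cD c₃ : ℕ) (coins₃ : Polynomial ℕ) (n : ℕ)
  (κu : ℚ) (bu : ℕ) (PGu : PGParams) (L : ℕ) (θN : ℚ) (sN NN PN wN RN : ℕ) (Mx : ℕ)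

/-- **The genuine record.** [folklore] -/
def c2RecOf : C2Rec :=
  ((((pRecOf (modulus n) κu bu PGu, c2M q m₃ cD c₃ n), (((modulus n), L), dim n + 1)),
      hRecOf (modulus n) L n (dim n + 1) θN sN NN PN wN RN),
    (tRecOf q m₃ c cD c₃ coins₃ n, (c2W₁ PGu Mx, c2W₂ q m₃ cD c₃ n L, c2W₃ n L, c2W₄ q m₃ cD c₃ n L PN wN RN)))

end Defs

/-! ### The programs -/

namespace C2Rec

variable (r : C2Rec)

/-- The raising sampler's record. [folklore] -/
abbrev prec : PRec := r.1.1.1.1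
/-- `M`. [folklore] -/
abbrev mM : ℕ := r.1.1.1.2
/-- `Q`. [folklore] -/
abbrev qQ : ℕ := r.1.1.2.1.1
/-- `L`. [folklore] -/
abbrev lL : ℕ := r.1.1.2.1.2
/-- `d+1`. [folklore] -/
abbrev d1 : ℕ := r.1.1.2.2
/-- Hybrid `T₂`'s record. [folklore] -/
abbrev hrec : HRec := r.1.2
/-- The test record. [folklore] -/
abbrev trec : TRec := r.2.1
/-- `W₁`. [folklore] -/
abbrev w1 : ℕ := r.2.2.1
/-- `W₂`. [folklore] -/
abbrev w2 : ℕ := r.2.2.2.1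
/-- `W₃`. [folklore] -/
abbrev w3 : ℕ := r.2.2.2.2.1
/-- `W₄`. [folklore] -/
abbrev w4 : ℕ := r.2.2.2.2.2

end C2Rec

/-- **The transformed items against the record** (regions left to right, nested `drop`s as in `c2Bit`). [cite: BrakerskiEtAl2013, Thm. 4.1 (proof)] -/
def c2ItemsOf (r : C2Rec) (x : List LItem × List Bool) : List LItem :=
  let r₁ := x.2.drop r.w1
  let r₂ := r₁.drop r.w2
  let r₃ := r₂.drop r.w3
  let S₀ := padFlat r.mM (raiseOf r.prec (x.1, x.2.take r.w1))
  let S₁ := dimExtFlat r.qQ r.lL S₀ (r₁.take r.w2)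
  let S₂ := shiftFlat r.qQ r.lL r.d1 S₁ (r₂.take r.w3)
  hybT2Of r.hrec (S₂, r₃.take r.w4)

/-- The coins left for the test. [folklore] -/
def c2RestOf (r : C2Rec) (coins : List Bool) : List Bool := (((coins.drop r.w1).drop r.w2).drop r.w3).drop r.w4

/-- **The `j`-th subroutine input of the test run on the transformed items, with the subroutine's own coins.** [cite: BrakerskiEtAl2013, Lemma 2.15 with §5; LadnerLynchSelman1975, §3] -/
def c2QueryOf (coins₃ : Polynomial ℕ) (r : C2Rec) (x : List LItem × (List Bool × ℕ)) : LData × List Bool :=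
  tQuery r.trec coins₃ (c2ItemsOf r (x.1, x.2.1)) (c2RestOf r x.2.1) x.2.2

/-- The verdict from the answer bits. [cite: BrakerskiEtAl2013, Lemma 2.15] -/
def c2VerdictOf (r : C2Rec) (ans : List Bool) : Bool := tVerdictOf r.trec ans

/-! ### Against the genuine record -/

section Genuine

variable (q m₃ : ℕ → ℕ) (c cD c₃ : ℕ) (coins₃ : Polynomial ℕ) (n : ℕ)
  (κu : ℚ) (bu : ℕ) (PGu : PGParams) (L : ℕ) (θN : ℚ) (sN NN PN wN RN : ℕ) (Mx : ℕ) (dec : List Bool → List Bool → Bool)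

/-- The transformed items at the genuine record, in closed form. [folklore] -/
theorem c2ItemsOf_c2RecOf (items : List LItem) (coins : List Bool) :
    c2ItemsOf (c2RecOf q m₃ c cD c₃ coins₃ n κu bu PGu L θN sN NN PN wN RN Mx) (items, coins) =
      hybT2Flat (modulus n) L n (dim n + 1) θN sN NN PN wN RN
        (shiftFlat (modulus n) L (dim n + 1)
          (dimExtFlat (modulus n) L (padFlat (c2M q m₃ cD c₃ n) (raiseFlat (modulus n) κu bu PGu items (coins.take (c2W₁ PGu Mx))))
            ((coins.drop (c2W₁ PGu Mx)).take (c2W₂ q m₃ cD c₃ n L)))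
          (((coins.drop (c2W₁ PGu Mx)).drop (c2W₂ q m₃ cD c₃ n L)).take (c2W₃ n L)))
        ((((coins.drop (c2W₁ PGu Mx)).drop (c2W₂ q m₃ cD c₃ n L)).drop (c2W₃ n L)).take (c2W₄ q m₃ cD c₃ n L PN wN RN)) := by
  unfold c2ItemsOf
  simp only [show (c2RecOf q m₃ c cD c₃ coins₃ n κu bu PGu L θN sN NN PN wN RN Mx).w1 = c2W₁ PGu Mx from rfl,
    show (c2RecOf q m₃ c cD c₃ coins₃ n κu bu PGu L θN sN NN PN wN RN Mx).w2 = c2W₂ q m₃ cD c₃ n L from rfl,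
    show (c2RecOf q m₃ c cD c₃ coins₃ n κu bu PGu L θN sN NN PN wN RN Mx).w3 = c2W₃ n L from rfl,
    show (c2RecOf q m₃ c cD c₃ coins₃ n κu bu PGu L θN sN NN PN wN RN Mx).w4 = c2W₄ q m₃ cD c₃ n L PN wN RN from rfl,
    show (c2RecOf q m₃ c cD c₃ coins₃ n κu bu PGu L θN sN NN PN wN RN Mx).mM = c2M q m₃ cD c₃ n from rfl,
    show (c2RecOf q m₃ c cD c₃ coins₃ n κu bu PGu L θN sN NN PN wN RN Mx).qQ = modulus n from rfl,
    show (c2RecOf q m₃ c cD c₃ coins₃ n κu bu PGu L θN sN NN PN wN RN Mx).lL = L from rfl,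
    show (c2RecOf q m₃ c cD c₃ coins₃ n κu bu PGu L θN sN NN PN wN RN Mx).d1 = dim n + 1 from rfl,
    show (c2RecOf q m₃ c cD c₃ coins₃ n κu bu PGu L θN sN NN PN wN RN Mx).prec = pRecOf (modulus n) κu bu PGu from rfl,
    show (c2RecOf q m₃ c cD c₃ coins₃ n κu bu PGu L θN sN NN PN wN RN Mx).hrec = hRecOf (modulus n) L n (dim n + 1) θN sN NN PN wN RN from rfl,
    raiseOf_eq, hybT2Of_hRecOf]

/-- The test's coins at the genuine record. [folklore] -/
theorem c2RestOf_c2RecOf (coins : List Bool) :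
    c2RestOf (c2RecOf q m₃ c cD c₃ coins₃ n κu bu PGu L θN sN NN PN wN RN Mx) coins =
      (((coins.drop (c2W₁ PGu Mx)).drop (c2W₂ q m₃ cD c₃ n L)).drop (c2W₃ n L)).drop (c2W₄ q m₃ cD c₃ n L PN wN RN) := rfl

/-- **The closed-form verdict bit is the verdict program on the answer bits of the query program's queries** (the answers being the subroutine's decisions `dec`).
[cite: BrakerskiEtAl2013, Thm. 4.1 (proof), Lemma 2.15] -/
theorem c2Bit_eq (items : List LItem) (coins : List Bool) :
    c2Bit q m₃ c cD c₃ coins₃ n κu bu PGu L θN sN NN PN wN RN Mx dec items coins =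
      c2VerdictOf (c2RecOf q m₃ c cD c₃ coins₃ n κu bu PGu L θN sN NN PN wN RN Mx)
        (List.ofFn fun j : Fin (gridG q cD n * gridBatches q cD c₃ n + gridBatches q cD c₃ n) =>
          dec (ldataE (c2QueryOf coins₃ (c2RecOf q m₃ c cD c₃ coins₃ n κu bu PGu L θN sN NN PN wN RN Mx) (items, (coins, j))).1)
            (c2QueryOf coins₃ (c2RecOf q m₃ c cD c₃ coins₃ n κu bu PGu L θN sN NN PN wN RN Mx) (items, (coins, j))).2) := by
  unfold c2VerdictOf c2QueryOf
  dsimp only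
  rw [c2ItemsOf_c2RecOf, c2RestOf_c2RecOf]
  rfl

end Genuine

/-! ### Typed polynomial time -/

section CodeFP

/-- The argument code `(record, (items, coins))`. [folklore] -/
abbrev c2ArgE : C2Rec × (List LItem × List Bool) → List Bool := pairE c2RecE (pairE (rawE itemRawE) strE)

/-- **The transformed items are typed polynomial time** in `(record, (items, coins))`. [cite: BrakerskiEtAl2013, §5; AroraBarak2009, §1.3] -/
theorem c2ItemsOf_codeFP : CodeFP c2ArgE (rawE itemRawE) (fun p => c2ItemsOf p.1 p.2) := by
  have hr : CodeFP c2ArgE c2RecE (fun p => p.1) := fst _ _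
  have hits : CodeFP c2ArgE (rawE itemRawE) (fun p => p.2.1) := (snd _ _).fst'
  have hc : CodeFP c2ArgE strE (fun p => p.2.2) := (snd _ _).snd'
  have hprec : CodeFP c2ArgE pRecE (fun p => p.1.prec) := hr.fst'.fst'.fst'.fst'
  have hM : CodeFP c2ArgE unE (fun p => p.1.mM) := hr.fst'.fst'.fst'.snd'
  have hQ : CodeFP c2ArgE natE (fun p => p.1.qQ) := hr.fst'.fst'.snd'.fst'.fst'
  have hL : CodeFP c2ArgE unE (fun p => p.1.lL) := hr.fst'.fst'.snd'.fst'.snd'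
  have hd1 : CodeFP c2ArgE unE (fun p => p.1.d1) := hr.fst'.fst'.snd'.snd'
  have hh : CodeFP c2ArgE hRecE (fun p => p.1.hrec) := hr.fst'.snd'
  have hw1 : CodeFP c2ArgE unE (fun p => p.1.w1) := hr.snd'.snd'.fst'
  have hw2 : CodeFP c2ArgE unE (fun p => p.1.w2) := hr.snd'.snd'.snd'.fst'
  have hw3 : CodeFP c2ArgE unE (fun p => p.1.w3) := hr.snd'.snd'.snd'.snd'.fst'
  have hw4 : CodeFP c2ArgE unE (fun p => p.1.w4) := hr.snd'.snd'.snd'.snd'.snd'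
  -- the regions
  have hr₁ : CodeFP c2ArgE strE (fun p => p.2.2.drop p.1.w1) := (strDrop.comp (hw1.pair hc) :)
  have hr₂ : CodeFP c2ArgE strE (fun p => (p.2.2.drop p.1.w1).drop p.1.w2) := (strDrop.comp (hw2.pair hr₁) :)
  have hr₃ : CodeFP c2ArgE strE (fun p => ((p.2.2.drop p.1.w1).drop p.1.w2).drop p.1.w3) := (strDrop.comp (hw3.pair hr₂) :)
  -- the stages
  have hS₀ : CodeFP c2ArgE (rawE itemRawE) (fun p => padFlat p.1.mM (raiseOf p.1.prec (p.2.1, p.2.2.take p.1.w1))) :=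
    (padFlat_codeFP.comp (hM.pair (raiseOf_codeFP.comp (hprec.pair (hits.pair (strTake.comp (hw1.pair hc)))))) :)
  have hS₁ : CodeFP c2ArgE (rawE itemRawE) (fun p => dimExtFlat p.1.qQ p.1.lL (padFlat p.1.mM (raiseOf p.1.prec (p.2.1, p.2.2.take p.1.w1)))
      ((p.2.2.drop p.1.w1).take p.1.w2)) :=
    (dimExtFlat_codeFP.comp ((hQ.pair hL).pair (hS₀.pair (strTake.comp (hw2.pair hr₁)))) :)
  have hS₂ : CodeFP c2ArgE (rawE itemRawE) (fun p => shiftFlat p.1.qQ p.1.lL p.1.d1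
      (dimExtFlat p.1.qQ p.1.lL (padFlat p.1.mM (raiseOf p.1.prec (p.2.1, p.2.2.take p.1.w1))) ((p.2.2.drop p.1.w1).take p.1.w2))
      (((p.2.2.drop p.1.w1).drop p.1.w2).take p.1.w3)) :=
    (shiftFlat_codeFP.comp ((hQ.pair (hL.pair hd1)).pair (hS₁.pair (strTake.comp (hw3.pair hr₂)))) :)
  have hS₃ := hybT2Of_codeFP.comp (hh.pair (hS₂.pair (strTake.comp (hw4.pair hr₃))))
  exact hS₃.congr fun p => rfl

/-- The test's coins are typed polynomial time in `(record, coins)`. [folklore] -/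
theorem c2RestOf_codeFP : CodeFP (pairE c2RecE strE) strE (fun p => c2RestOf p.1 p.2) := by
  have hr : CodeFP (pairE c2RecE strE) c2RecE (fun p => p.1) := fst _ _
  have hc : CodeFP (pairE c2RecE strE) strE (fun p => p.2) := snd _ _
  have hw1 : CodeFP (pairE c2RecE strE) unE (fun p => p.1.w1) := hr.snd'.snd'.fst'
  have hw2 : CodeFP (pairE c2RecE strE) unE (fun p => p.1.w2) := hr.snd'.snd'.snd'.fst'
  have hw3 : CodeFP (pairE c2RecE strE) unE (fun p => p.1.w3) := hr.snd'.snd'.snd'.snd'.fst'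
  have hw4 : CodeFP (pairE c2RecE strE) unE (fun p => p.1.w4) := hr.snd'.snd'.snd'.snd'.snd'
  exact ((strDrop.comp (hw4.pair (strDrop.comp (hw3.pair (strDrop.comp (hw2.pair (strDrop.comp (hw1.pair hc)))))))).congr fun p => rfl)

/-- The argument code `(record, (items, (coins, j)))` of the query. [folklore] -/
abbrev c2QArgE : C2Rec × (List LItem × (List Bool × ℕ)) → List Bool := pairE c2RecE (pairE (rawE itemRawE) (pairE strE natE))

/-- **The `j`-th subroutine input of the candidate-2 run is typed polynomial time** in `(record, (items, (coins, j)))`.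
[cite: BrakerskiEtAl2013, §5; AroraBarak2009, §1.3, §3.4] -/
theorem c2QueryOf_codeFP (coins₃ : Polynomial ℕ) : CodeFP c2QArgE (pairE ldataE strE) (fun p => c2QueryOf coins₃ p.1 p.2) := by
  have hr : CodeFP c2QArgE c2RecE (fun p => p.1) := fst _ _
  have hits : CodeFP c2QArgE (rawE itemRawE) (fun p => p.2.1) := (snd _ _).fst'
  have hc : CodeFP c2QArgE strE (fun p => p.2.2.1) := (snd _ _).snd'.fst'
  have hj : CodeFP c2QArgE natE (fun p => p.2.2.2) := (snd _ _).snd'.snd'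
  have htrec : CodeFP c2QArgE tRecE (fun p => p.1.trec) := hr.snd'.fst'
  have hitems' : CodeFP c2QArgE (rawE itemRawE) (fun p => c2ItemsOf p.1 (p.2.1, p.2.2.1)) := (c2ItemsOf_codeFP.comp (hr.pair (hits.pair hc)) :)
  have hrest : CodeFP c2QArgE strE (fun p => c2RestOf p.1 p.2.2.1) := (c2RestOf_codeFP.comp (hr.pair hc) :)
  exact (((tQuery_codeFP coins₃).comp (htrec.pair (hitems'.pair (hrest.pair hj)))).congr fun p => rfl)

/-- The verdict is typed polynomial time in `(record, answers)`. [cite: AroraBarak2009, §1.3] -/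
theorem c2VerdictOf_codeFP : CodeFP (pairE c2RecE (rawE bitE)) bitE (fun p => c2VerdictOf p.1 p.2) :=
  (tVerdictOf_codeFP.comp ((fst _ _).snd'.fst'.pair (snd _ _))).congr fun _ => rfl

end CodeFP

end KProg

end BLPRS2013

end Literature.Computability.Cryptography

end
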